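import Summits.ResolutionOfSingularities.ResolutionOfSingularities.Theorems.EquisingularLiftEquisingularLiftNatTowerRuledDefs
import Summits.ResolutionOfSingularities.ResolutionOfSingularities.Theorems.EquisingularLiftEquisingularLiftNatTowerExceptionalDense
import HarnessLib

/-!
# [OURS · L1 W4.5(b) · EL♮(3)] The cone round's two remaining stand-ins of res-D-pv-029's assembly `hsub_reachTower_three_of`, DISCHARGED:
# S4 `hIso` (transport of `DirLift.Ruled` along `V(St 𝓔) ≅ V(𝓔)`) and S5 `hDense` (`E ⊆ closure (E ∖ Z)` from `Tower.Inv₂` + `ConeWitness`)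

Crux chain w45b (cell `res-hironaka`, slot W4.5(b)), working crux **EL♮** = stmt-ResolutionOfSingularities-20038, child **EL♮(3)** =
stmt-ResolutionOfSingularities-20148, route EquisingularLift, line `sections`; registered stub `stub_elnat_coneTowerPointResolution` (@ `ReachTower₂`,
moving to `ReachTower₃` by RULING-7), clause (round), cone-witnessed disjunct. Written by res-L1-w45b-stub-2 g7 against the stand-in list S0–S10 of
res-D-pv-029's assembly skeleton (STATUS 19:36:17Z; res-L1-w45b-plan-1 ACK 19:37:21Z «S4 ⇐ stub-2's ruled_of_iso, S5»). HONEST FRAMING: OURS; NOT a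
statement of any manuscript; AI-written, weaker than expert review. No `sorry`; standard axioms; DEF-FREE.
`--supports stmt-ResolutionOfSingularities-20148 --as helper`.

WHAT.
* `DirLift.ruled_of_round_old` — S4 `hIso` VERBATIM in shape, for `Ruled := DirLift.Ruled O k θ P q Y`: the datum of the OLD exceptional surface
  is transported through a round with centre `𝓔 ⊔ 𝒦` along the isomorphism `V(St 𝓔) ≅ V(𝓔)` over the blow-up (one `DirLift.ruled_comp`; the
  stand-in's blow-up / model-square / trace hypotheses are kept only to match its shape).
* `Tower.subset_closure_diff_of_inv₂` — S5 `hDense` VERBATIM in shape after the prefix `(O k θ hθ P q Y Ch Ruled)`, for ANY `Ruled`: from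
  `Tower.Inv₂ … G γ T E K`, `TowerFull Z`, `Z ⊆ E` and `ConeWitness G E hE K Z hZ` — `E ⊆ closure (E ∖ Z)`. Cases of `Tower.Exc₂`/`Tower.Shadow₂`:
  `NoRound` contradicts `TowerFull` (`Tower.not_towerFull_of_noRound`); `K = ∅` forces `Z = E ∩ closure ∅ = ∅`; otherwise (e-i), (k-ii) + the cone
  witness give `(𝓔 ⊔ 𝒦)·𝒪_G = 𝓘⟨Z⟩` and `subset_closure_diff_of_flat_of_isEffectiveCartier` (…NatTowerExceptionalDense: (k-iii) flat + (k-vi)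
  Cartier, stalk-local regular-pair argument) concludes. No ruled-surface datum is used.

References (index only): res-D-pv-029 `D/res-D-pv-029/gen8/TowerAssembly.lean` (S0–S10), …NatTowerInvDefs p556392, …NatTowerConeRoundOld p560701;
res-L1-w45b-stub-2 …NatTowerRuledDefs p561677, …NatTowerExceptionalDense.
-/

set_option linter.dupNamespace false -- mandated namespace `Summit.<Summit>.<Problem>` of this single-conjunct summit
set_option linter.overlappingInstances false -- the binders carry `[IsDomain O] [IsDiscreteValuationRing O]`

noncomputable section

open CategoryTheory CategoryTheory.Limits AlgebraicGeometry TopologicalSpace Topology IsLocalRing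
open Literature.AlgebraicGeometry.Resolution
open AlgebraicGeometry.Scheme.IdealSheafData

namespace Summit.ResolutionOfSingularities.ResolutionOfSingularities.Cruxes.EquisingularLiftNat.Sections

/-- **S4 `hIso` for `DirLift.Ruled`**: transport of the ruled-surface datum of the OLD exceptional surface through a round with centre
`𝓔 ⊔ 𝒦`, along an isomorphism `V(St 𝓔) ≅ V(𝓔)` over the blow-up `τ` — res-D-pv-029's stand-in shape verbatim (its hypotheses
«`τ` blows up `𝓔 ⊔ 𝒦`», model square and trace are not needed by the transport). [OURS · pure logic over …NatTowerRuledDefs] -/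
theorem DirLift.ruled_of_round_old (O : Type) [CommRing O] (k : Type) [Field k] (θ : O →+* k)
    (P : Scheme.{0}) (q : P ⟶ Spec (.of O)) (Y : Set P) :
    ∀ {F₉ : Scheme.{0}} (Z₉ : Set F₉) (hZ₉ : IsClosed Z₉) {F₁₀ : Scheme.{0}} (υ' : F₁₀ ⟶ F₉)
        (G G' : Scheme.{0}) (γ : G ⟶ F₁₀) (E : Set G) (Z : Set G) (hZ : IsClosed Z) (υ₂ : G' ⟶ G)
        (X : Scheme.{0}) (σ : X ⟶ P) (jG : G ⟶ X) (𝓔 𝒦 : X.IdealSheafData) (X'' : Scheme.{0}) (τ : X'' ⟶ X)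
        (j₂ : G' ⟶ X'') (t₂ : G' ⟶ Spec (.of k)),
        IsBlowup τ (𝓔 ⊔ 𝒦) → IsPullback j₂ t₂ ((τ ≫ σ) ≫ q) (Spec.map (CommRingCat.ofHom θ)) → j₂ ≫ τ = υ₂ ≫ jG →
        (𝓔 ⊔ 𝒦).comap jG = vanishingIdeal ⟨Z, hZ⟩ →
        (∃ e : (strictTransformIdeal τ (𝓔 ⊔ 𝒦) 𝓔).subscheme ≅ 𝓔.subscheme,
          e.hom ≫ 𝓔.subschemeι = (strictTransformIdeal τ (𝓔 ⊔ 𝒦) 𝓔).subschemeι ≫ τ) →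
        DirLift.Ruled O k θ P q Y F₉ Z₉ hZ₉ F₁₀ υ' G γ E X σ jG 𝓔 →
        DirLift.Ruled O k θ P q Y F₉ Z₉ hZ₉ F₁₀ υ' G' (υ₂ ≫ γ) (closure (υ₂ ⁻¹' (E \ Z))) X'' (τ ≫ σ) j₂
          (strictTransformIdeal τ (𝓔 ⊔ 𝒦) 𝓔) := by
  intro F₉ Z₉ hZ₉ F₁₀ υ' G G' γ E Z hZ υ₂ X σ jG 𝓔 𝒦 X'' τ j₂ t₂ _ _ hcomm _ he h
  obtain ⟨e, he⟩ := he
  exact DirLift.ruled_comp h τ υ₂ j₂ hcomm (strictTransformIdeal τ (𝓔 ⊔ 𝒦) 𝓔) e he _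

/-- **S5 `hDense`, for ANY ruled-surface datum `Ruled`**: at a cone-witnessed round the centre `Z` is nowhere dense in the exceptional surface,
`E ⊆ closure (E ∖ Z)` — from `Tower.Inv₂` (`Tower.Exc₂`: `NoRound` is excluded by `TowerFull`; `Tower.Shadow₂`: `K = ∅` forces `Z = ∅`, else
(e-i)/(k-ii) + the cone witness give the exact trace of `𝓔 ⊔ 𝒦` and (k-iii) flat + (k-vi) Cartier conclude by
`subset_closure_diff_of_flat_of_isEffectiveCartier`). res-D-pv-029's stand-in shape verbatim after the prefix `(O k θ hθ P q Y Ch Ruled)`.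
[cite: Matsumura1987, §16] [OURS · L1 W4.5b] toward `stub_elnat_coneTowerPointResolution`; NOT a statement of the manuscript. -/
theorem Tower.subset_closure_diff_of_inv₂ (O : Type) [CommRing O] [IsDomain O] [IsDiscreteValuationRing O] (k : Type) [Field k]
    (θ : O →+* k) (hθ : Function.Surjective θ) (P : Scheme.{0}) (q : P ⟶ Spec (.of O)) (Y : Set P)
    (Ch : ∀ X' : Scheme.{0}, (X' ⟶ P) → Set X' → Prop) (Ruled : Tower.RuledDatum P) :
    ∀ {F₉ : Scheme.{0}} (Z₉ : Set F₉) (hZ₉ : IsClosed Z₉) {F₁₀ : Scheme.{0}} (υ' : F₁₀ ⟶ F₉)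
        (G : Scheme.{0}) (γ : G ⟶ F₁₀) (T E K : Set G) (hE : IsClosed E) (Z : Set G) (hZ : IsClosed Z),
        Tower.Inv₂ O k θ P q Y Ch Ruled F₉ Z₉ hZ₉ F₁₀ υ' G γ T E K → TowerFull F₉ F₁₀ υ' Z₉ hZ₉ G γ Z hZ → Z ⊆ E →
        ConeWitness G E hE K Z hZ → E ⊆ closure (E \ Z) := by
  intro F₉ Z₉ hZ₉ F₁₀ υ' G γ T E K hE Z hZ hinv hfull hZE hcone
  obtain ⟨-, hZinf, -, -, -, -, -, X, σ, S, jG, tG, -, -, hXnoeth, -, -, hsq, -, hexc⟩ := hinv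
  haveI := hXnoeth
  rcases hexc hE with hno | ⟨𝓔, he_i, -, -, -, -, hshadow⟩
  · exact absurd hfull (Tower.not_towerFull_of_noRound υ' Z₉ hZ₉ hZinf G γ E hno Z hZ hZE)
  · rcases hshadow with hK | ⟨𝒦, -, hk_ii, hk_iii, -, -, hk_vi⟩
    · -- the shadow is forgotten: a cone witness against `K = ∅` forces `Z = ∅`
      obtain ⟨hZeq, -⟩ := hcone
      rw [hK, closure_empty, Set.inter_empty] at hZeq
      rw [hZeq, Set.sdiff_empty]
      exact subset_closure
    · refine subset_closure_diff_of_flat_of_isEffectiveCartier θ hθ q σ jG tG hsq 𝓔 𝒦 hE hZ he_i ?_ hk_iii hk_vi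
      obtain ⟨-, hideal⟩ := hcone
      rw [Scheme.IdealSheafData.comap_sup, he_i, hk_ii, hideal]

end Summit.ResolutionOfSingularities.ResolutionOfSingularities.Cruxes.EquisingularLiftNat.Sections

end
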